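import Summits.Ventures.PackingBounds.Configurations.E8GroundState

/-!
# From universal optimality to ground-state rigidity for power-series, absolutely monotone and Riesz potentials

Framing: lottery ticket; floor = certified bounds/negative ranges. Venture `PackingBounds` (cell
`pub-packcert`, seat `pub-packcert-energy`) — generic plumbing used by the ground-state uniqueness files of
the sharp configurations (`…GroundState.lean`), abstracted from `E8EnergyRigidity.isometric_E8_of_energy_eq` /
`E8GroundState`.

Setting: a finite `C ⊂ S^{n-1}` whose `(1+t)^k`-energies `E_k = Σ_{x ≠ y} (1 + ⟪x,y⟫)^k` dominate a model
sequence `B_k = N Σ_i m_i (1 + t_i)^k` for EVERY `k` (universal optimality in the tree's polynomial form).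

* `ckPow_energy_eq_of_hasSum`: if `a(s) = Σ_k c_k (1+s)^k` on `[-1,1)` with `c_k ≥ 0` and the `a`-energy of `C`
  equals the model value `N Σ_i m_i a(t_i)`, then `E_k = B_k` for every `k` with `c_k > 0`
  (the nonnegative series `Σ c_k (E_k - B_k)` sums to `0`).
* `ckPow_energy_eq_of_absolutelyMonotoneOn`: the same for `a` absolutely monotone on `[-1,1)` with
  `a^{(k)}(-1) > 0` (S. Bernstein: `Literature…AbsolutelyMonotonePowerSeries.hasSum_taylor`).
* `ckPow_energy_eq_of_riesz`: the same for every Riesz potential `(2 - 2t)^{-p}`, `p > 0`, and every `k`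
  (`E8GroundState.iteratedDerivWithin_rpow_chordal_pos`).

Combined with a rigidity theorem "`E_k = B_k` for one large `k` ⇒ `C` is the model configuration" this gives
uniqueness of the ground state for all these potentials.

## References
* H. Cohn, A. Kumar, J. Amer. Math. Soc. 20 (2007) 99–148, Theorem 1.2. [`CohnKumar2006`]
* D. V. Widder, *The Laplace Transform* (1941), Ch. IV Thm. 3a. [`Widder1941`]
-/

noncomputable section

namespace Summit.Ventures.PackingBounds.Config.GroundStateSeries

open Finset Set Literature.Analysis.Calculus

/-- If `B_k ≤ E_k`, `c_k ≥ 0`, and the series `Σ c_k E_k`, `Σ c_k B_k` have the same sum, then `E_k = B_k`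
wherever `c_k > 0`. -/
theorem eq_of_hasSum_eq {E B c : ℕ → ℝ} (hEB : ∀ k, B k ≤ E k) (hc : ∀ k, 0 ≤ c k) {A : ℝ}
    (hE : HasSum (fun k => c k * E k) A) (hB : HasSum (fun k => c k * B k) A) {k₀ : ℕ} (hk₀ : 0 < c k₀) :
    E k₀ = B k₀ := by
  have hdiff : HasSum (fun k => c k * (E k - B k)) 0 := by
    have h := hE.sub hB
    rw [sub_self] at h
    refine h.congr_fun fun k => ?_
    ring
  have hnonneg : ∀ k, 0 ≤ c k * (E k - B k) := fun k => mul_nonneg (hc k) (by linarith [hEB k])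
  have hzero := (hasSum_zero_iff_of_nonneg hnonneg).mp hdiff
  have hk0 : c k₀ * (E k₀ - B k₀) = 0 := by simpa using congrFun hzero k₀
  rcases mul_eq_zero.mp hk0 with h | h
  · exact absurd h hk₀.ne'
  · linarith

section config

variable {n r : ℕ} {C : Finset (EuclideanSpace ℝ (Fin n))} (h1 : ∀ x ∈ C, ‖x‖ = 1)
  (N : ℝ) (t m : Fin r → ℝ) (ht : ∀ i, -1 ≤ t i ∧ t i < 1)
  (hEB : ∀ k, N * ∑ i, m i * (1 + t i) ^ k ≤ ∑ x ∈ C, ∑ y ∈ C.erase x, (1 + inner ℝ x y) ^ k)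
include h1 ht hEB

/-- **Power-series potentials.** If `a(s) = Σ c_k (1+s)^k` on `[-1,1)` with `c_k ≥ 0`, the `(1+t)^k`-energies of
`C` dominate `N Σ_i m_i (1+t_i)^k` for all `k`, and the `a`-energy of `C` equals `N Σ_i m_i a(t_i)`, then the
`(1+t)^{k₀}`-energy of `C` equals `N Σ_i m_i (1+t_i)^{k₀}` for every `k₀` with `c_{k₀} > 0`. -/
theorem ckPow_energy_eq_of_hasSum (a : ℝ → ℝ) (c : ℕ → ℝ) (hc : ∀ k, 0 ≤ c k)
    (ha : ∀ s : ℝ, -1 ≤ s → s < 1 → HasSum (fun k => c k * (1 + s) ^ k) (a s))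
    (hE : ∑ x ∈ C, ∑ y ∈ C.erase x, a (inner ℝ x y) = N * ∑ i, m i * a (t i))
    {k₀ : ℕ} (hk₀ : 0 < c k₀) :
    ∑ x ∈ C, ∑ y ∈ C.erase x, (1 + inner ℝ x y) ^ k₀ = N * ∑ i, m i * (1 + t i) ^ k₀ := by
  have hsC : ∀ x ∈ C, ∀ y ∈ C.erase x,
      HasSum (fun k => c k * (1 + inner ℝ x y) ^ k) (a (inner ℝ x y)) := by
    intro x hx y hy
    have hb := Energy.NewtonCert.inner_mem_Ico_of_norm_eq_one (h1 x hx) (h1 y (Finset.mem_of_mem_erase hy))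
      (Finset.ne_of_mem_erase hy).symm
    exact ha _ hb.1 hb.2
  have hR : HasSum (fun k => c k * ∑ x ∈ C, ∑ y ∈ C.erase x, (1 + inner ℝ x y) ^ k)
      (∑ x ∈ C, ∑ y ∈ C.erase x, a (inner ℝ x y)) := by
    have h := hasSum_sum fun x (hx : x ∈ C) => hasSum_sum fun y (hy : y ∈ C.erase x) => hsC x hx y hy
    refine h.congr_fun fun k => ?_
    simp only [Finset.mul_sum]
  have hL : HasSum (fun k => c k * (N * ∑ i, m i * (1 + t i) ^ k)) (N * ∑ i, m i * a (t i)) := by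
    have h := (hasSum_sum fun i (_ : i ∈ (univ : Finset (Fin r))) =>
      (ha (t i) (ht i).1 (ht i).2).mul_left (m i)).mul_left N
    refine h.congr_fun fun k => ?_
    simp only [Finset.mul_sum]
    exact Finset.sum_congr rfl fun i _ => by ring
  rw [hE] at hR
  exact eq_of_hasSum_eq hEB hc hR hL hk₀

/-- **Absolutely monotone potentials** (Bernstein): if `a` is absolutely monotone on `[-1,1)` with
`a^{(k₀)}(-1) > 0` and the `a`-energy of `C` equals `N Σ_i m_i a(t_i)`, then the `(1+t)^{k₀}`-energy of `C` equals
`N Σ_i m_i (1+t_i)^{k₀}`. [cite: Widder1941, Chapter IV Theorem 3a] -/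
theorem ckPow_energy_eq_of_absolutelyMonotoneOn (a : ℝ → ℝ) (ha : AbsolutelyMonotoneOn a (Ico (-1) 1))
    {k₀ : ℕ} (hpos : 0 < iteratedDerivWithin k₀ a (Ico (-1) 1) (-1))
    (hE : ∑ x ∈ C, ∑ y ∈ C.erase x, a (inner ℝ x y) = N * ∑ i, m i * a (t i)) :
    ∑ x ∈ C, ∑ y ∈ C.erase x, (1 + inner ℝ x y) ^ k₀ = N * ∑ i, m i * (1 + t i) ^ k₀ := by
  set c : ℕ → ℝ := fun k => iteratedDerivWithin k a (Ico (-1) 1) (-1) / (Nat.factorial k) with hc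
  have hc0 : ∀ k, 0 ≤ c k := fun k =>
    div_nonneg (ha.iteratedDerivWithin_nonneg (uniqueDiffOn_Ico (-1) 1) k ⟨le_rfl, by norm_num⟩)
      (Nat.cast_nonneg _)
  have hsum : ∀ s : ℝ, -1 ≤ s → s < 1 → HasSum (fun k => c k * (1 + s) ^ k) (a s) := by
    intro s hs1 hs2
    have h := AbsolutelyMonotonePowerSeries.hasSum_taylor ha (x := s) ⟨hs1, hs2⟩
    simpa only [hc, sub_neg_eq_add, add_comm s 1] using h
  have hck : 0 < c k₀ := div_pos hpos (by positivity)
  exact ckPow_energy_eq_of_hasSum h1 N t m ht hEB a c hc0 hsum hE hck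

/-- **Riesz potentials**: if the `(2 - 2t)^{-p}`-energy (`= Σ |x-y|^{-2p}`, `p > 0`) of `C` equals
`N Σ_i m_i (2 - 2t_i)^{-p}`, then for EVERY `k` the `(1+t)^k`-energy of `C` equals `N Σ_i m_i (1+t_i)^k`.
[cite: CohnKumar2006, Theorem 1.2] -/
theorem ckPow_energy_eq_of_riesz (p : ℝ) (hp : 0 < p)
    (hE : ∑ x ∈ C, ∑ y ∈ C.erase x, (2 - 2 * inner ℝ x y) ^ (-p) = N * ∑ i, m i * (2 - 2 * t i) ^ (-p))
    (k₀ : ℕ) :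
    ∑ x ∈ C, ∑ y ∈ C.erase x, (1 + inner ℝ x y) ^ k₀ = N * ∑ i, m i * (1 + t i) ^ k₀ :=
  ckPow_energy_eq_of_absolutelyMonotoneOn h1 N t m ht hEB (fun s : ℝ => (2 - 2 * s) ^ (-p))
    (Energy.RieszAbsolutelyMonotone.absolutelyMonotoneOn_rpow_chordal p hp.le)
    (E8GroundState.iteratedDerivWithin_rpow_chordal_pos p hp k₀) hE

end config

end Summit.Ventures.PackingBounds.Config.GroundStateSeries

end
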